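import Summits.Ventures.WeilGRH.TwistedWindowSectors
import Summits.RiemannHypothesis.RiemannHypothesis.Theorems.WeilFormatCWindowGram
import HarnessLib

/-!
# GRH arm (rh-explicit, venture WeilGRH): the sesquilinear twisted window form and its Gram expansion
  on finite families — the matrix interface of `χ`-twisted Fourier–Galerkin certificates

Cell `rh-explicit`, WEIL TRACK — GRH ARM (typing seat weil-grh-1).  Sequel of `TwistedWindowForm.lean`
(the dictionary `weilPositivityOnChar_of_twistedWindowForm_sum_chi_nonneg`) and `TwistedWindowSectors.lean`
(per-parity certificates for real `χ`), and the `χ`-twisted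
analogue of the format-C files `WeilFormatCDefs/WindowSesq/WindowGram.lean` (weil-3).

* `weilTwistIncrementSesq ω u v t = ∫ (u(x+t) − ω u(x)) conj(v(x+t) − ω v(x)) dx` — polarisation of the
  twisted increment `weilTwistIncrement ω` (`…_self`), hermitian, linear in `u`;
* `twistedWindowSesq χ a u v` — polarisation of the twisted window form
  `𝓔^χ_a(u) − M^χ_a‖u‖₂²` (`twistedWindowSesq_self`): twisted prime increments weighted by
  `Λ(n)n^{-1/2}`, the parity-`a_χ` archimedean density against the (untwisted) sesquilinear increment
  `weilIncrementSesq`, and `−M^χ_a ∫ u conj v`; hermitian (`…_conj_symm`), linear in the first argument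
  over window functions (`…_smul_left`, `…_add_left`);
* **the Gram expansion** `twistedWindowForm_sum_smul`:
  `𝓔^χ_a(Σ c_i u_i) − M^χ_a‖Σ c_i u_i‖₂² = Σ_i Σ_j c_i conj(c_j) twistedWindowSesq χ a u_i u_j`;
* **the certificate interface** on Yoshida's windows `χ_n = (2a)^{-1/2}e^{iπnx/a}𝟙_{[-a,a]}`:
  `weilPositivityOnChar_of_twisted_gram_nonneg` (hermitian Gram form `≥ 0` for all `N` ⟹
  `WeilPositivityOnChar χ a`, `q ≠ 1`, `a > 0`), `weilPositivityOnChar_of_twisted_real_gram_psd` (real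
  Gram entries and real PSD certificates suffice) and `weilPositivityOnChar_of_twisted_real_gram_sector_psd`
  (real `χ`: PSD on EVEN real vectors and on ODD real vectors separately suffices — one certificate per
  (χ, sector), the shape of EXTREMALS/GRH/Kt-closure-log3half-CERT).

Definitions carry docstrings; everything else is proved; no named facts; RH/GRH-free.  Not here: the
closed forms of the entries `twistedWindowSesq χ a χ_m χ_n` (Yoshida (5.13)–(5.16) with the twist and
the parity) and the sector (parity of `u`) reduction.
-/

set_option autoImplicit false

noncomputable section

open Complex Filter Set MeasureTheory
open scoped Real Topology ComplexConjugate ArithmeticFunction.vonMangoldt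

namespace Summit.Ventures.WeilGRH

open Literature.NumberTheory.LFunctions
open Literature.NumberTheory.LFunctions.Yoshida1992 (modes chi)
open Summit.RiemannHypothesis.RiemannHypothesis.Theorems.WeilFormatC

variable {q : ℕ} {a : ℝ} {u v u₁ u₂ : ℝ → ℂ}

/-! ## Definitions -/

/-- The **sesquilinear twisted increment** `D^ω_t(u, v) = ∫ (u(x+t) − ω u(x)) · conj (v(x+t) − ω v(x)) dx`
(polarisation of `weilTwistIncrement ω`: `D^ω_t(u, u) = D^ω_t(u)`). -/
def weilTwistIncrementSesq (ω : ℂ) (u v : ℝ → ℂ) (t : ℝ) : ℂ :=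
  ∫ x : ℝ, (u (x + t) - ω * u x) * conj (v (x + t) - ω * v x)

/-- The **sesquilinear twisted window form** of `[-a, a]` for the Dirichlet character `χ` mod `q`:
`S^χ_a(u, v) = Σ_{log n < 2a} Λ(n) n^{-1/2} D^{χ̄(n)}_{log n}(u, v) + ∫₀^∞ ρ_{a_χ}(t) D_t(u, v) dt − M^χ_a ∫ u conj v`
(polarisation of the twisted window form `𝓔^χ_a(u) − M^χ_a‖u‖₂²` of `TwistedWindowForm.lean`; linear in
`u`, conjugate-linear in `v`).  Its matrix on Yoshida's basis `χ_n` is the Gram matrix a `χ`-twisted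
Fourier–Galerkin certificate computes. -/
def twistedWindowSesq (χ : DirichletCharacter ℂ q) (a : ℝ) (u v : ℝ → ℂ) : ℂ :=
  (∑ n ∈ weilPrimeIndex a, ((Λ n : ℝ) / Real.sqrt n : ℂ) *
      weilTwistIncrementSesq (conj (χ (n : ZMod q))) u v (Real.log n)) +
    (∫ t in Ioi (0 : ℝ), (weilArchDensityPar (charParity χ) t : ℂ) * weilIncrementSesq u v t) -
    (weilMarkovConstantChar χ a : ℂ) * ∫ x : ℝ, u x * conj (v x)

/-! ## The twisted increment: integrability, diagonal, symmetry, linearity -/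

/-- The twisted shift `x ↦ u(x+t) − ω u(x)` of a window function: measurable, `0` off
`[-a − |t|, a + |t|]`, bounded by `(1 + ‖ω‖)S`. -/
theorem twist_shift_sub_window (hu : IsWindowFunction a u) (ω : ℂ) (t : ℝ) :
    Measurable (fun x ↦ u (x + t) - ω * u x) ∧
      (∀ x, x ∉ Icc (-a - |t|) (a + |t|) → u (x + t) - ω * u x = 0) ∧
      ∃ S : ℝ, 0 ≤ S ∧ ∀ x, ‖u (x + t) - ω * u x‖ ≤ S := by
  obtain ⟨S, hS0, hS⟩ := hu.bounded'
  refine ⟨(hu.measurable.comp (measurable_id.add_const t)).sub (hu.measurable.const_mul ω),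
    fun x hx ↦ ?_, ⟨S + ‖ω‖ * S, by positivity, fun x ↦ (norm_sub_le _ _).trans
      (add_le_add (hS _) (by rw [norm_mul]; exact mul_le_mul_of_nonneg_left (hS _) (norm_nonneg _)))⟩⟩
  rw [mem_Icc, not_and_or, not_le, not_le] at hx
  have hx1 : x ∉ Icc (-a) a := by
    intro h; rcases hx with h' | h' <;> linarith [h.1, h.2, abs_nonneg t]
  have hx2 : x + t ∉ Icc (-a) a := by
    intro h; rcases hx with h' | h' <;> linarith [h.1, h.2, le_abs_self t, neg_abs_le t]
  rw [hu.eq_zero _ hx1, hu.eq_zero _ hx2, mul_zero, sub_zero]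

/-- The sesquilinear twisted increment integrand of two window functions is integrable. -/
theorem integrable_twistIncrementSesq_window (hu : IsWindowFunction a u)
    (hv : IsWindowFunction a v) (ω : ℂ) (t : ℝ) :
    Integrable fun x ↦ (u (x + t) - ω * u x) * conj (v (x + t) - ω * v x) := by
  obtain ⟨hmE, hzE, S, hS0, hS⟩ := twist_shift_sub_window hu ω t
  obtain ⟨hmF, -, T, hT0, hT⟩ := twist_shift_sub_window hv ω t
  have hint : Integrable fun x ↦ (Icc (-a - |t|) (a + |t|)).indicator (fun _ ↦ S * T) x :=
    (integrable_indicator_iff measurableSet_Icc).2 (integrableOn_const (by simp [Real.volume_Icc]))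
  refine hint.mono' ((hmE.mul (Complex.continuous_conj.measurable.comp hmF)).aestronglyMeasurable)
    (Eventually.of_forall fun x ↦ ?_)
  by_cases hx : x ∈ Icc (-a - |t|) (a + |t|)
  · rw [indicator_of_mem hx, norm_mul, Complex.norm_conj]
    exact mul_le_mul (hS x) (hT x) (norm_nonneg _) hS0
  · rw [hzE x hx, indicator_of_notMem hx, zero_mul, norm_zero]

/-- `z · conj z = |z|²` as a cast real. -/
private theorem mul_conj_eq_norm_sq' (z : ℂ) : z * conj z = ((‖z‖ ^ 2 : ℝ) : ℂ) := by
  rw [Complex.mul_conj, Complex.normSq_eq_norm_sq]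

/-- `D^ω_t(u, u) = D^ω_t(u)`. -/
theorem weilTwistIncrementSesq_self (ω : ℂ) (u : ℝ → ℂ) (t : ℝ) :
    weilTwistIncrementSesq ω u u t = (weilTwistIncrement ω u t : ℂ) := by
  unfold weilTwistIncrementSesq weilTwistIncrement
  rw [← integral_complex_ofReal]
  exact integral_congr_ae (Eventually.of_forall fun x ↦ mul_conj_eq_norm_sq' _)

/-- `D^ω_t(v, u) = conj D^ω_t(u, v)` (no hypothesis). -/
theorem weilTwistIncrementSesq_conj_symm (ω : ℂ) (u v : ℝ → ℂ) (t : ℝ) :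
    weilTwistIncrementSesq ω v u t = conj (weilTwistIncrementSesq ω u v t) := by
  unfold weilTwistIncrementSesq
  rw [← integral_conj]
  refine integral_congr_ae (Eventually.of_forall fun x ↦ ?_)
  simp only [map_mul, Complex.conj_conj]
  ring

/-- `D^ω_t(c u, v) = c D^ω_t(u, v)` (no hypothesis). -/
theorem weilTwistIncrementSesq_smul_left (ω c : ℂ) (u v : ℝ → ℂ) (t : ℝ) :
    weilTwistIncrementSesq ω (c • u) v t = c * weilTwistIncrementSesq ω u v t := by
  unfold weilTwistIncrementSesq
  rw [← integral_const_mul]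
  refine integral_congr_ae (Eventually.of_forall fun x ↦ ?_)
  simp only [Pi.smul_apply, smul_eq_mul]
  ring

/-- `D^ω_t(u₁ + u₂, v) = D^ω_t(u₁, v) + D^ω_t(u₂, v)` for window functions. -/
theorem weilTwistIncrementSesq_add_left (hu₁ : IsWindowFunction a u₁) (hu₂ : IsWindowFunction a u₂)
    (hv : IsWindowFunction a v) (ω : ℂ) (t : ℝ) :
    weilTwistIncrementSesq ω (u₁ + u₂) v t =
      weilTwistIncrementSesq ω u₁ v t + weilTwistIncrementSesq ω u₂ v t := by
  unfold weilTwistIncrementSesq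
  rw [← integral_add (integrable_twistIncrementSesq_window hu₁ hv ω t)
    (integrable_twistIncrementSesq_window hu₂ hv ω t)]
  refine integral_congr_ae (Eventually.of_forall fun x ↦ ?_)
  simp only [Pi.add_apply]
  ring

/-! ## The archimedean part with parity: absolute convergence for window functions -/

/-- `t ↦ ρ_κ(t) D_t(u, v)` is integrable on `(0, ∞)` for window functions (`a ≥ 0`): domination by
`ρ_0(t)(D_t(u) + D_t(v))/2`. -/
theorem integrableOn_weilArchDensityPar_mul_weilIncrementSesq (ha : 0 ≤ a) (hu : IsWindowFunction a u)
    (hv : IsWindowFunction a v) (κ : ℕ) :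
    IntegrableOn (fun t ↦ (weilArchDensityPar κ t : ℂ) * weilIncrementSesq u v t) (Ioi 0) := by
  have hI : IntegrableOn (fun t ↦ (weilArchDensity t * weilIncrement u t +
      weilArchDensity t * weilIncrement v t) / 2) (Ioi 0) :=
    ((hu.integrableOn_arch ha).add (hv.integrableOn_arch ha)).div_const 2
  refine hI.mono' ?_ ?_
  · exact ((Complex.continuous_ofReal.measurable.comp (measurable_weilArchDensityPar κ)).mul
      (measurable_weilIncrementSesq hu.measurable hv.measurable)).aestronglyMeasurable
  · refine (ae_restrict_iff' measurableSet_Ioi).2 (Eventually.of_forall fun t ht ↦ ?_)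
    obtain ⟨h0, hle⟩ := weilArchDensityPar_nonneg_le κ ht
    rw [norm_mul, Complex.norm_real, Real.norm_of_nonneg h0]
    have hD : 0 ≤ (weilIncrement u t + weilIncrement v t) / 2 :=
      div_nonneg (add_nonneg (weilIncrement_nonneg _ _) (weilIncrement_nonneg _ _)) two_pos.le
    calc weilArchDensityPar κ t * ‖weilIncrementSesq u v t‖
        ≤ weilArchDensityPar κ t * ((weilIncrement u t + weilIncrement v t) / 2) :=
          mul_le_mul_of_nonneg_left (norm_weilIncrementSesq_le hu hv t) h0
      _ ≤ weilArchDensity t * ((weilIncrement u t + weilIncrement v t) / 2) :=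
          mul_le_mul_of_nonneg_right hle hD
      _ = (weilArchDensity t * weilIncrement u t + weilArchDensity t * weilIncrement v t) / 2 := by
          ring

/-! ## The diagonal is the twisted window form; hermitian symmetry; linearity -/

/-- **The diagonal of the sesquilinear twisted window form is the twisted window form**:
`twistedWindowSesq χ a u u = 𝓔^χ_a(u) − M^χ_a‖u‖₂²` (no hypothesis on `u`). -/
theorem twistedWindowSesq_self (χ : DirichletCharacter ℂ q) (a : ℝ) (u : ℝ → ℂ) :
    twistedWindowSesq χ a u u =
      ((weilDirichletEnergyChar χ a u - weilMarkovConstantChar χ a * ∫ x : ℝ, ‖u x‖ ^ 2 : ℝ) : ℂ) := by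
  unfold twistedWindowSesq weilDirichletEnergyChar
  simp_rw [weilTwistIncrementSesq_self, weilIncrementSesq_self]
  have harch : ∫ t in Ioi (0 : ℝ), (weilArchDensityPar (charParity χ) t : ℂ) * (weilIncrement u t : ℂ) =
      ((∫ t in Ioi (0 : ℝ), weilArchDensityPar (charParity χ) t * weilIncrement u t : ℝ) : ℂ) := by
    rw [← integral_complex_ofReal]
    exact integral_congr_ae (Eventually.of_forall fun t ↦ by push_cast; rfl)
  have hnorm : ∫ x : ℝ, u x * conj (u x) = ((∫ x : ℝ, ‖u x‖ ^ 2 : ℝ) : ℂ) := by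
    rw [← integral_complex_ofReal]
    exact integral_congr_ae (Eventually.of_forall fun x ↦ mul_conj_eq_norm_sq' _)
  rw [harch, hnorm]
  push_cast
  ring

/-- **Hermitian symmetry**: `twistedWindowSesq χ a v u = conj (twistedWindowSesq χ a u v)`. -/
theorem twistedWindowSesq_conj_symm (χ : DirichletCharacter ℂ q) (a : ℝ) (u v : ℝ → ℂ) :
    twistedWindowSesq χ a v u = conj (twistedWindowSesq χ a u v) := by
  have hdiv : ∀ n : ℕ, conj (((Λ n : ℝ) / Real.sqrt n : ℂ)) = ((Λ n : ℝ) / Real.sqrt n : ℂ) := by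
    intro n
    rw [map_div₀, Complex.conj_ofReal, Complex.conj_ofReal]
  have hsum : ∑ n ∈ weilPrimeIndex a, ((Λ n : ℝ) / Real.sqrt n : ℂ) *
      weilTwistIncrementSesq (conj (χ (n : ZMod q))) v u (Real.log n) =
      conj (∑ n ∈ weilPrimeIndex a, ((Λ n : ℝ) / Real.sqrt n : ℂ) *
        weilTwistIncrementSesq (conj (χ (n : ZMod q))) u v (Real.log n)) := by
    rw [map_sum]
    refine Finset.sum_congr rfl fun n _ ↦ ?_
    rw [map_mul, hdiv, weilTwistIncrementSesq_conj_symm]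
  have harch : ∫ t in Ioi (0 : ℝ), (weilArchDensityPar (charParity χ) t : ℂ) * weilIncrementSesq v u t =
      conj (∫ t in Ioi (0 : ℝ), (weilArchDensityPar (charParity χ) t : ℂ) * weilIncrementSesq u v t) := by
    rw [← integral_conj]
    refine integral_congr_ae (Eventually.of_forall fun t ↦ ?_)
    beta_reduce
    rw [map_mul, Complex.conj_ofReal, weilIncrementSesq_conj_symm]
  have hinner : ∫ x : ℝ, v x * conj (u x) = conj (∫ x : ℝ, u x * conj (v x)) := by
    rw [← integral_conj]
    refine integral_congr_ae (Eventually.of_forall fun x ↦ ?_)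
    simp only [map_mul, Complex.conj_conj]
    ring
  unfold twistedWindowSesq
  rw [hsum, harch, hinner]
  simp only [map_add, map_sub, map_mul, Complex.conj_ofReal]

/-- **Homogeneity**: `twistedWindowSesq χ a (c • u) v = c · twistedWindowSesq χ a u v`. -/
theorem twistedWindowSesq_smul_left (χ : DirichletCharacter ℂ q) (a : ℝ) (c : ℂ) (u v : ℝ → ℂ) :
    twistedWindowSesq χ a (c • u) v = c * twistedWindowSesq χ a u v := by
  unfold twistedWindowSesq
  simp_rw [weilTwistIncrementSesq_smul_left, weilIncrementSesq_smul_left]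
  have harch : ∫ t in Ioi (0 : ℝ), (weilArchDensityPar (charParity χ) t : ℂ) * (c * weilIncrementSesq u v t) =
      c * ∫ t in Ioi (0 : ℝ), (weilArchDensityPar (charParity χ) t : ℂ) * weilIncrementSesq u v t := by
    rw [← integral_const_mul]
    exact integral_congr_ae (Eventually.of_forall fun t ↦ by ring)
  have hinner : ∫ x : ℝ, (c • u) x * conj (v x) = c * ∫ x : ℝ, u x * conj (v x) := by
    rw [← integral_const_mul]
    refine integral_congr_ae (Eventually.of_forall fun x ↦ ?_)
    simp only [Pi.smul_apply, smul_eq_mul, mul_assoc]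
  have hsum : ∑ n ∈ weilPrimeIndex a, ((Λ n : ℝ) / Real.sqrt n : ℂ) *
      (c * weilTwistIncrementSesq (conj (χ (n : ZMod q))) u v (Real.log n)) =
      c * ∑ n ∈ weilPrimeIndex a, ((Λ n : ℝ) / Real.sqrt n : ℂ) *
        weilTwistIncrementSesq (conj (χ (n : ZMod q))) u v (Real.log n) := by
    rw [Finset.mul_sum]
    exact Finset.sum_congr rfl fun n _ ↦ by ring
  rw [harch, hinner, hsum]
  ring

/-- **Additivity in the first argument** for window functions on `[-b, b]`, `b ≥ 0`:
`twistedWindowSesq χ a (u₁ + u₂) v = twistedWindowSesq χ a u₁ v + twistedWindowSesq χ a u₂ v`. -/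
theorem twistedWindowSesq_add_left (χ : DirichletCharacter ℂ q) {b : ℝ} (hb : 0 ≤ b)
    (hu₁ : IsWindowFunction b u₁) (hu₂ : IsWindowFunction b u₂) (hv : IsWindowFunction b v) (a : ℝ) :
    twistedWindowSesq χ a (u₁ + u₂) v = twistedWindowSesq χ a u₁ v + twistedWindowSesq χ a u₂ v := by
  unfold twistedWindowSesq
  simp_rw [weilTwistIncrementSesq_add_left hu₁ hu₂ hv, weilIncrementSesq_add_left hu₁ hu₂ hv]
  have harch : ∫ t in Ioi (0 : ℝ), (weilArchDensityPar (charParity χ) t : ℂ) *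
      (weilIncrementSesq u₁ v t + weilIncrementSesq u₂ v t) =
      (∫ t in Ioi (0 : ℝ), (weilArchDensityPar (charParity χ) t : ℂ) * weilIncrementSesq u₁ v t) +
        ∫ t in Ioi (0 : ℝ), (weilArchDensityPar (charParity χ) t : ℂ) * weilIncrementSesq u₂ v t := by
    rw [← integral_add (integrableOn_weilArchDensityPar_mul_weilIncrementSesq hb hu₁ hv _)
      (integrableOn_weilArchDensityPar_mul_weilIncrementSesq hb hu₂ hv _)]
    exact integral_congr_ae (Eventually.of_forall fun t ↦ mul_add _ _ _)
  have hinner : ∫ x : ℝ, (u₁ + u₂) x * conj (v x) =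
      (∫ x : ℝ, u₁ x * conj (v x)) + ∫ x : ℝ, u₂ x * conj (v x) := by
    rw [← integral_add (hu₁.integrable_mul_conj hv) (hu₂.integrable_mul_conj hv)]
    exact integral_congr_ae (Eventually.of_forall fun x ↦ by simp only [Pi.add_apply, add_mul])
  have hsum : ∑ n ∈ weilPrimeIndex a, ((Λ n : ℝ) / Real.sqrt n : ℂ) *
      (weilTwistIncrementSesq (conj (χ (n : ZMod q))) u₁ v (Real.log n) +
        weilTwistIncrementSesq (conj (χ (n : ZMod q))) u₂ v (Real.log n)) =
      (∑ n ∈ weilPrimeIndex a, ((Λ n : ℝ) / Real.sqrt n : ℂ) *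
        weilTwistIncrementSesq (conj (χ (n : ZMod q))) u₁ v (Real.log n)) +
        ∑ n ∈ weilPrimeIndex a, ((Λ n : ℝ) / Real.sqrt n : ℂ) *
          weilTwistIncrementSesq (conj (χ (n : ZMod q))) u₂ v (Real.log n) := by
    rw [← Finset.sum_add_distrib]
    exact Finset.sum_congr rfl fun n _ ↦ mul_add _ _ _
  rw [harch, hinner, hsum]
  ring

/-! ## Finite linear combinations and the Gram expansion -/

/-- Linearity of the sesquilinear twisted window form in the first argument over finite sums of window
functions (`b ≥ 0`). -/
theorem twistedWindowSesq_sum_left (χ : DirichletCharacter ℂ q) {b : ℝ} (hb : 0 ≤ b) {ι : Type*}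
    (s : Finset ι) {w : ι → ℝ → ℂ} (hw : ∀ i ∈ s, IsWindowFunction b (w i)) {v : ℝ → ℂ}
    (hv : IsWindowFunction b v) (c : ι → ℂ) (a : ℝ) :
    twistedWindowSesq χ a (∑ i ∈ s, c i • w i) v = ∑ i ∈ s, c i * twistedWindowSesq χ a (w i) v := by
  classical
  induction s using Finset.induction_on with
  | empty =>
    simp only [Finset.sum_empty]
    have h := twistedWindowSesq_smul_left χ a 0 (0 : ℝ → ℂ) v
    rw [zero_mul, zero_smul] at h
    exact h
  | insert i s hi ih =>
    rw [Finset.sum_insert hi, Finset.sum_insert hi,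
      twistedWindowSesq_add_left χ hb ((hw i (Finset.mem_insert_self i s)).smul (c i))
        (IsWindowFunction.sum s c fun j hj ↦ hw j (Finset.mem_insert_of_mem hj)) hv,
      twistedWindowSesq_smul_left, ih fun j hj ↦ hw j (Finset.mem_insert_of_mem hj)]

/-- Conjugate-linearity in the second argument over finite sums of window functions (`b ≥ 0`). -/
theorem twistedWindowSesq_sum_right (χ : DirichletCharacter ℂ q) {b : ℝ} (hb : 0 ≤ b) {ι : Type*}
    (s : Finset ι) {w : ι → ℝ → ℂ} (hw : ∀ j ∈ s, IsWindowFunction b (w j)) {u : ℝ → ℂ}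
    (hu : IsWindowFunction b u) (c : ι → ℂ) (a : ℝ) :
    twistedWindowSesq χ a u (∑ j ∈ s, c j • w j) = ∑ j ∈ s, conj (c j) * twistedWindowSesq χ a u (w j) := by
  rw [twistedWindowSesq_conj_symm, twistedWindowSesq_sum_left χ hb s hw hu c a, map_sum]
  refine Finset.sum_congr rfl fun j _ ↦ ?_
  rw [map_mul, ← twistedWindowSesq_conj_symm]

/-- **The Gram expansion of the twisted window form.**  For window functions `w_i` on `[-b, b]`
(`b ≥ 0`) and coefficients `c`,
`𝓔^χ_a(Σ c_i w_i) − M^χ_a‖Σ c_i w_i‖₂² = Σ_i Σ_j c_i conj(c_j) twistedWindowSesq χ a w_i w_j` (in `ℂ`). -/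
theorem twistedWindowForm_sum_smul (χ : DirichletCharacter ℂ q) {b : ℝ} (hb : 0 ≤ b) {ι : Type*}
    (s : Finset ι) {w : ι → ℝ → ℂ} (hw : ∀ i ∈ s, IsWindowFunction b (w i)) (c : ι → ℂ) (a : ℝ) :
    ((weilDirichletEnergyChar χ a (∑ i ∈ s, c i • w i) -
        weilMarkovConstantChar χ a * ∫ x : ℝ, ‖(∑ i ∈ s, c i • w i) x‖ ^ 2 : ℝ) : ℂ) =
      ∑ i ∈ s, ∑ j ∈ s, c i * conj (c j) * twistedWindowSesq χ a (w i) (w j) := by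
  rw [← twistedWindowSesq_self, twistedWindowSesq_sum_left χ hb s hw (IsWindowFunction.sum s c hw) c a]
  refine Finset.sum_congr rfl fun i hi ↦ ?_
  rw [twistedWindowSesq_sum_right χ hb s hw (hw i hi) c a, Finset.mul_sum]
  exact Finset.sum_congr rfl fun j _ ↦ by ring

/-- Real-part form of the Gram expansion. -/
theorem twistedWindowForm_sum_smul_eq_re (χ : DirichletCharacter ℂ q) {b : ℝ} (hb : 0 ≤ b)
    {ι : Type*} (s : Finset ι) {w : ι → ℝ → ℂ} (hw : ∀ i ∈ s, IsWindowFunction b (w i)) (c : ι → ℂ)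
    (a : ℝ) :
    weilDirichletEnergyChar χ a (∑ i ∈ s, c i • w i) -
        weilMarkovConstantChar χ a * ∫ x : ℝ, ‖(∑ i ∈ s, c i • w i) x‖ ^ 2 =
      (∑ i ∈ s, ∑ j ∈ s, c i * conj (c j) * twistedWindowSesq χ a (w i) (w j)).re := by
  rw [← twistedWindowForm_sum_smul χ hb s hw c a, Complex.ofReal_re]

/-! ## The certificate interface on Yoshida's trigonometric windows -/

/-- **The `χ`-twisted format-C interface.**  For `a > 0`, every `N` and all coefficients `c : ℤ → ℂ`,
`𝓔^χ_a(Σ_{|n|≤N} c_nχ_n) − M^χ_a‖Σ_{|n|≤N} c_nχ_n‖₂² = Σ_m Σ_n c_m conj(c_n) G^χ(m, n)` with the GRAM MATRIX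
`G^χ(m, n) = twistedWindowSesq χ a (chi a m) (chi a n)` (hermitian by `twistedWindowSesq_conj_symm`). -/
theorem twistedWindowForm_sum_smul_chi (χ : DirichletCharacter ℂ q) (ha : 0 < a) (N : ℕ) (c : ℤ → ℂ) :
    ((weilDirichletEnergyChar χ a (∑ n ∈ modes N, c n • chi a n) -
        weilMarkovConstantChar χ a * ∫ x : ℝ, ‖(∑ n ∈ modes N, c n • chi a n) x‖ ^ 2 : ℝ) : ℂ) =
      ∑ m ∈ modes N, ∑ n ∈ modes N, c m * conj (c n) * twistedWindowSesq χ a (chi a m) (chi a n) :=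
  twistedWindowForm_sum_smul χ ha.le (modes N) (fun n _ ↦ isWindowFunction_chi ha n) c a

/-- **From a twisted Gram certificate to a rung of the GRH arm.**  `q ≠ 1`, `a > 0`: if for every `N`
and every coefficient vector the hermitian form of the Gram matrix `G^χ(m,n) = twistedWindowSesq χ a χ_m χ_n`
has non-negative real part, then `WeilPositivityOnChar χ a`. -/
theorem weilPositivityOnChar_of_twisted_gram_nonneg (hq : q ≠ 1) (χ : DirichletCharacter ℂ q)
    (ha : 0 < a)
    (h : ∀ (N : ℕ) (c : ℤ → ℂ), 0 ≤ (∑ m ∈ modes N, ∑ n ∈ modes N,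
      c m * conj (c n) * twistedWindowSesq χ a (chi a m) (chi a n)).re) :
    WeilPositivityOnChar χ a := by
  refine weilPositivityOnChar_of_twistedWindowForm_sum_chi_nonneg hq χ ha fun N c ↦ ?_
  rw [twistedWindowForm_sum_smul_eq_re χ ha.le (modes N) (fun n _ ↦ isWindowFunction_chi ha n) c a]
  exact h N c

/-- **Real Gram certificates suffice when the entries are real** (e.g. for a real character): if
`G^χ(m,n) = twistedWindowSesq χ a χ_m χ_n` has real entries and `Σ_{m,n} x_m x_n Re G^χ(m,n) ≥ 0` for every
`N` and every REAL vector `x : ℤ → ℝ` (an exact `LDLᵀ` / interval-PSD certificate of the real symmetric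
matrix), then `WeilPositivityOnChar χ a` (`q ≠ 1`, `a > 0`). -/
theorem weilPositivityOnChar_of_twisted_real_gram_psd (hq : q ≠ 1) (χ : DirichletCharacter ℂ q)
    (ha : 0 < a) (hreal : ∀ m n : ℤ, (twistedWindowSesq χ a (chi a m) (chi a n)).im = 0)
    (hpsd : ∀ (N : ℕ) (x : ℤ → ℝ), 0 ≤ ∑ m ∈ modes N, ∑ n ∈ modes N,
      x m * x n * (twistedWindowSesq χ a (chi a m) (chi a n)).re) :
    WeilPositivityOnChar χ a :=
  weilPositivityOnChar_of_twisted_gram_nonneg hq χ ha fun N c ↦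
    re_sum_sum_mul_conj_mul_nonneg (modes N) (fun m _ n _ ↦ hreal m n) (fun _ ↦ True)
      (fun x _ ↦ hpsd N x) c trivial trivial

/-- **Real SECTOR Gram certificates suffice for a real character.**  `q ≠ 1`, `a > 0`, `conj χ = χ`,
real Gram entries: if the real quadratic form `Σ x_m x_n Re G^χ(m,n)` is `≥ 0` on every EVEN real vector
(`x_{-n} = x_n`) and on every ODD real vector (`x_{-n} = −x_n`), for every `N`, then
`WeilPositivityOnChar χ a`. -/
theorem weilPositivityOnChar_of_twisted_real_gram_sector_psd (hq : q ≠ 1) (χ : DirichletCharacter ℂ q)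
    (hχ : ∀ n : ℕ, conj (χ (n : ZMod q)) = χ (n : ZMod q)) (ha : 0 < a)
    (hreal : ∀ m n : ℤ, (twistedWindowSesq χ a (chi a m) (chi a n)).im = 0)
    (hev : ∀ (N : ℕ) (x : ℤ → ℝ), (∀ n, x (-n) = x n) → 0 ≤ ∑ m ∈ modes N, ∑ n ∈ modes N,
      x m * x n * (twistedWindowSesq χ a (chi a m) (chi a n)).re)
    (hod : ∀ (N : ℕ) (x : ℤ → ℝ), (∀ n, x (-n) = -x n) → 0 ≤ ∑ m ∈ modes N, ∑ n ∈ modes N,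
      x m * x n * (twistedWindowSesq χ a (chi a m) (chi a n)).re) :
    WeilPositivityOnChar χ a := by
  refine weilPositivityOnChar_of_twisted_sector_nonneg hq χ hχ ha (fun N c hc ↦ ?_) (fun N c hc ↦ ?_)
  · rw [twistedWindowForm_sum_smul_eq_re χ ha.le (modes N) (fun n _ ↦ isWindowFunction_chi ha n) c a]
    exact re_sum_sum_mul_conj_mul_nonneg (modes N) (fun m _ n _ ↦ hreal m n)
      (fun x ↦ ∀ n, x (-n) = x n) (fun x hx ↦ hev N x hx) c
      (fun n ↦ by simp only [hc n]) (fun n ↦ by simp only [hc n])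
  · rw [twistedWindowForm_sum_smul_eq_re χ ha.le (modes N) (fun n _ ↦ isWindowFunction_chi ha n) c a]
    exact re_sum_sum_mul_conj_mul_nonneg (modes N) (fun m _ n _ ↦ hreal m n)
      (fun x ↦ ∀ n, x (-n) = -x n) (fun x hx ↦ hod N x hx) c
      (fun n ↦ by simp only [hc n, Complex.neg_re]) (fun n ↦ by simp only [hc n, Complex.neg_im])

end Summit.Ventures.WeilGRH

end
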